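import Literature.MeasureTheory.Group.InvariantQuotientDiscreteFibre
import Literature.MeasureTheory.Group.InvariantQuotientCompactFibre
import Mathlib.Algebra.Group.Conj
import Mathlib.Algebra.Group.Subgroup.Pointwise
import HarnessLib

/-!
# The sum over `Γ` rearranged by conjugacy classes:
`∫_{G ⧸ L} Σ_{γ ∈ Γ} F(x γ x⁻¹) dμ = Σ_{[γ]} d_γ ∫_{G ⧸ G_γ} F(y γ y⁻¹) dμ_γ`
(Gelbart, *Automorphic forms on adele groups* (1975), (9.11)–(9.13) and Remark 9.23; Selberg)

Topic `MeasureTheory/Group`. This file PROVES the measure-theoretic heart of the geometric side of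
the trace formula for a compact quotient (Gelbart (1975), §9, "some elementary manipulations"
leading from (9.12) to (9.13); Remark 9.23 for a division quaternion algebra): the integral over
`X = G ⧸ L` of the diagonal kernel `Σ_{γ ∈ Γ} F(x γ x⁻¹)` is a sum over the conjugacy classes `[γ]`
of `Γ` of positive constants times **orbital integrals** `∫_{G ⧸ G_γ} F(y γ y⁻¹)`.

Setting: `G` locally compact second countable Hausdorff group; `Γ ≤ L ≤ G` with `L` closed,
`Γ` countable and `L = Γ · Z` for a subgroup `Z` centralising `Γ` (hypothesis
`∀ ℓ ∈ L, ∃ γ ∈ Γ, γ⁻¹ ℓ ∈ C_G(Γ)`; in the automorphic application `L = A_G · G(K)`, `Γ = G(K)`,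
`A_G` central). For `γ ∈ Γ` let `G_γ` be a closed subgroup centralising `γ` and containing
`H_γ = L ∩ C_G(γ)` (e.g. `G_γ = C_G(γ)`), with `H_γ` relatively open in `L` (true when `A_G` is open
in `L`) and `G_γ ⧸ H_γ` compact. Given non-zero `G`-invariant Borel measures finite on compact sets
`μ` on `G ⧸ L`, `μ_γ^H` on `G ⧸ H_γ` and `μ_γ` on `G ⧸ G_γ`:

* `descConj γ M _ F : G ⧸ M → α`, the descent of `y ↦ F(y γ y⁻¹)` to `G ⧸ M` for `M` centralising
  `γ` (**definition**; the orbital integrand), Borel for Borel `F` (`measurable_descConj`);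
* `conjTsum L S _ F : G ⧸ L → [0, ∞]`, the descent of `x ↦ Σ'_{s ∈ S} F(x s x⁻¹)` for an
  `L`-stable set `S` (**definition**; the diagonal kernel for `S = Γ`), Borel for countable `S`
  (`measurable_conjTsum`); `conjOrbit Γ γ = {δ γ δ⁻¹ : δ ∈ Γ}` (**definition**);
* `conjTsum_subgroup_eq_tsum_conjOrbit` — `Σ_{γ ∈ Γ} = Σ_{[γ]} Σ_{s ∈ [γ]}` (classes of `Γ`);
* `tsum_descConj_smul_inclQuot_eq` — the fibre of `G ⧸ H_γ → G ⧸ L` over `xL` is the class of `γ`: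
  `Σ_{z ∈ L ⧸ H_γ} F((x ℓ_z) γ (x ℓ_z)⁻¹) = Σ_{s ∈ [γ]} F(x s x⁻¹)` (bijection `ℓ H_γ ↦ ℓ γ ℓ⁻¹`);
* `exists_lintegral_conjTsum_conjOrbit_eq` — **one class**: there is `d_γ ∈ (0, ∞)` with
  `∫_{G ⧸ L} Σ_{s ∈ [γ]} F(x s x⁻¹) dμ = d_γ ∫_{G ⧸ G_γ} F(y γ y⁻¹) dμ_γ` for all Borel `F ≥ 0`
  (discrete fibre `InvariantQuotientDiscreteFibre` from `G ⧸ H_γ` down to `G ⧸ L`, compact fibre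
  `InvariantQuotientCompactFibre` from `G ⧸ H_γ` down to `G ⧸ G_γ`);
* `exists_lintegral_conjTsum_eq_tsum` — **the geometric side** (Gelbart (9.13), Remark 9.23):
  `∫_{G ⧸ L} Σ_{γ ∈ Γ} F(x γ x⁻¹) dμ(x) = Σ'_{[γ]} d_{[γ]} ∫_{G ⧸ G_γ} F(y γ y⁻¹) dμ_γ(y)` with
  constants `d_{[γ]} ∈ (0, ∞)` independent of `F`. CAVEAT: the printed constants are the volumes
  `vol(Γ(γ) A \ G_γ)` for Tamagawa-normalised measures; here the `d_{[γ]}` are only shown to be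
  positive and finite (they come from the uniqueness of invariant measures), and their
  identification with volumes is NOT proved in this file.
* `integral_conjTsum_eq_tsum_of_lintegral`, `integral_conjTsum_eq_tsum_of_lintegral_complex` —
  the same identity for **real and complex** Borel `F` with
  `∫_{G ⧸ L} Σ_{γ} ‖F(x γ x⁻¹)‖ dμ < ∞` (Bochner integrals, absolutely convergent right-hand side,
  integrability of all terms), deduced from the `[0, ∞]`-valued identity via `F⁺`, `F⁻`, `|F|`
  and real/imaginary parts (`conjTsum` takes values in any commutative topological additive
  monoid; `conjTsum_real_eq_toReal_sub`).

Part of the inline (D-0026) decomposition of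
`Literature.NumberTheory.Automorphic.strong_multiplicity_one_quaternionUnits` (Gelbart's proof of
Thm. 10.5 via the trace formula for `D^×`, (10.14) = Remark 9.23).

## References

* S. Gelbart, *Automorphic forms on adele groups*, Ann. of Math. Studies 83 (1975), §9,
  (9.11)–(9.13), Remark 9.23, (10.14) [Gelbart1975].
* D. Bump, *Automorphic Forms and Representations* (1997), §1.5–1.6 (Selberg trace formula,
  compact quotient) [Bump1997].
-/

noncomputable section

open _root_.MeasureTheory _root_.MeasureTheory.Measure _root_.Topology Set Filter
open scoped ENNReal NNReal Pointwise

/- Work with Borel structures on the coset spaces, as in `InvariantQuotientChainRule`. -/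
attribute [-instance] Quotient.instMeasurableSpace QuotientGroup.measurableSpace

namespace Literature.MeasureTheory.Group

/-! ### Conjugation algebra -/

section Algebra

variable {G : Type*} [Group G]

/-- `(g m) γ (g m)⁻¹ = g γ g⁻¹` when `m` commutes with `γ`. [folklore] -/
theorem mul_conj_eq_of_commute {γ g m : G} (hm : m * γ = γ * m) :
    g * m * γ * (g * m)⁻¹ = g * γ * g⁻¹ := by
  calc g * m * γ * (g * m)⁻¹ = g * (m * γ) * m⁻¹ * g⁻¹ := by group
    _ = g * (γ * m) * m⁻¹ * g⁻¹ := by rw [hm]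
    _ = g * γ * g⁻¹ := by group

/-- `ℓ s ℓ⁻¹ = γ s γ⁻¹` when `γ⁻¹ ℓ` commutes with `s`. [folklore] -/
theorem conj_eq_conj_of_commute {ℓ γ s : G} (hz : s * (γ⁻¹ * ℓ) = γ⁻¹ * ℓ * s) :
    ℓ * s * ℓ⁻¹ = γ * s * γ⁻¹ := by
  calc ℓ * s * ℓ⁻¹ = γ * (γ⁻¹ * ℓ * s) * (γ⁻¹ * ℓ)⁻¹ * γ⁻¹ := by group
    _ = γ * (s * (γ⁻¹ * ℓ)) * (γ⁻¹ * ℓ)⁻¹ * γ⁻¹ := by rw [hz]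
    _ = γ * s * γ⁻¹ := by group

/-- If `ℓ γ ℓ⁻¹ = ℓ' γ ℓ'⁻¹` then `ℓ⁻¹ ℓ'` commutes with `γ`. [folklore] -/
theorem inv_mul_commute_of_conj_eq {ℓ ℓ' γ : G} (h : ℓ * γ * ℓ⁻¹ = ℓ' * γ * ℓ'⁻¹) :
    ℓ⁻¹ * ℓ' * γ = γ * (ℓ⁻¹ * ℓ') := by
  have h2 : γ = ℓ⁻¹ * (ℓ' * γ * ℓ'⁻¹) * ℓ := by rw [← h]; group
  conv_rhs => rw [h2]
  group

variable (Γ L : Subgroup G)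

/-- **`L = Γ · C_L(Γ)` makes `Γ` stable under `L`-conjugation.** [folklore] -/
theorem conj_mem_subgroup_of_exists
    (hLΓ : ∀ ℓ ∈ L, ∃ γ ∈ Γ, γ⁻¹ * ℓ ∈ Subgroup.centralizer (Γ : Set G)) :
    ∀ ℓ ∈ L, ∀ s ∈ (Γ : Set G), ℓ * s * ℓ⁻¹ ∈ (Γ : Set G) := by
  intro ℓ hℓ s hs
  obtain ⟨γ, hγ, hz⟩ := hLΓ ℓ hℓ
  rw [conj_eq_conj_of_commute (Subgroup.mem_centralizer_iff.1 hz s hs)]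
  exact Γ.mul_mem (Γ.mul_mem hγ hs) (Γ.inv_mem hγ)

/-- **The `Γ`-conjugacy class** `{δ γ₀ δ⁻¹ : δ ∈ Γ} ⊆ G` of `γ₀`. [folklore] -/
def conjOrbit (γ₀ : G) : Set G := Set.range fun δ : Γ => (δ : G) * γ₀ * (δ : G)⁻¹

/-- Membership in `conjOrbit`. [folklore] -/
theorem mem_conjOrbit_iff {γ₀ s : G} : s ∈ conjOrbit Γ γ₀ ↔ ∃ δ ∈ Γ, δ * γ₀ * δ⁻¹ = s := by
  constructor
  · rintro ⟨δ, rfl⟩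
    exact ⟨δ, δ.2, rfl⟩
  · rintro ⟨δ, hδ, rfl⟩
    exact ⟨⟨δ, hδ⟩, rfl⟩

/-- `γ₀ ∈ conjOrbit Γ γ₀`. [folklore] -/
theorem self_mem_conjOrbit (γ₀ : G) : γ₀ ∈ conjOrbit Γ γ₀ :=
  (mem_conjOrbit_iff Γ).2 ⟨1, Γ.one_mem, by group⟩

/-- A conjugacy class of `Γ` lies in `Γ` (for `γ₀ ∈ Γ`). [folklore] -/
theorem conjOrbit_subset {γ₀ : G} (hγ₀ : γ₀ ∈ Γ) : conjOrbit Γ γ₀ ⊆ (Γ : Set G) := by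
  rintro s ⟨δ, rfl⟩
  exact Γ.mul_mem (Γ.mul_mem δ.2 hγ₀) (Γ.inv_mem δ.2)

/-- A conjugacy class of a countable `Γ` is countable. [folklore] -/
theorem countable_conjOrbit [Countable Γ] (γ₀ : G) : Countable (conjOrbit Γ γ₀) :=
  (Set.countable_range _).to_subtype

/-- **`L = Γ · C_L(Γ)` makes each `Γ`-conjugacy class stable under `L`-conjugation.** [folklore] -/
theorem conj_mem_conjOrbit_of_exists
    (hLΓ : ∀ ℓ ∈ L, ∃ γ ∈ Γ, γ⁻¹ * ℓ ∈ Subgroup.centralizer (Γ : Set G)) {γ₀ : G} (hγ₀ : γ₀ ∈ Γ) :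
    ∀ ℓ ∈ L, ∀ s ∈ conjOrbit Γ γ₀, ℓ * s * ℓ⁻¹ ∈ conjOrbit Γ γ₀ := by
  intro ℓ hℓ s hs
  obtain ⟨γ, hγ, hz⟩ := hLΓ ℓ hℓ
  obtain ⟨δ, hδ, rfl⟩ := (mem_conjOrbit_iff Γ).1 hs
  rw [conj_eq_conj_of_commute (Subgroup.mem_centralizer_iff.1 hz _
    (Γ.mul_mem (Γ.mul_mem hδ hγ₀) (Γ.inv_mem hδ)))]
  exact (mem_conjOrbit_iff Γ).2 ⟨γ * δ, Γ.mul_mem hγ hδ, by group⟩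

/-- In `L = A ⊔ Γ` with `A` central, every `ℓ ∈ L` is `γ a` with `γ ∈ Γ` and `a = γ⁻¹ ℓ`
central, in particular in `C_G(Γ)` (the hypothesis `L = Γ · C_L(Γ)` of this file in the
automorphic situation `L = A_G · G(K)`). [folklore] -/
theorem exists_inv_mul_mem_centralizer_of_le_center (A : Subgroup G)
    (hA : A ≤ Subgroup.center G) :
    ∀ ℓ ∈ A ⊔ Γ, ∃ γ ∈ Γ, γ⁻¹ * ℓ ∈ Subgroup.centralizer (Γ : Set G) := by
  haveI : A.Normal := ⟨fun a ha g => by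
    rw [Subgroup.mem_center_iff.1 (hA ha) g, mul_inv_cancel_right]
    exact ha⟩
  intro ℓ hℓ
  have hℓ' : ℓ ∈ ((A ⊔ Γ : Subgroup G) : Set G) := hℓ
  rw [Subgroup.normal_mul] at hℓ'
  obtain ⟨a, ha, γ, hγ, rfl⟩ := Set.mem_mul.1 hℓ'
  refine ⟨γ, hγ, Subgroup.center_le_centralizer _ ?_⟩
  have hcomm : γ⁻¹ * (a * γ) = a := by
    rw [← (Subgroup.mem_center_iff.1 (hA ha) γ), ← mul_assoc, inv_mul_cancel, one_mul]
  rw [hcomm]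
  exact hA ha

end Algebra

/-! ### The orbital integrand: descent of `y ↦ F(y γ₀ y⁻¹)` to `G ⧸ M` -/

section DescConj

variable {G : Type*} [Group G] (γ₀ : G) (M : Subgroup G) (hM : ∀ m ∈ M, m * γ₀ = γ₀ * m)

/-- **The orbital integrand** `descConj γ₀ M _ F : G ⧸ M → α`, `y M ↦ F(y γ₀ y⁻¹)`, for a
subgroup `M` centralising `γ₀` (well defined: `(y m) γ₀ (y m)⁻¹ = y γ₀ y⁻¹`). With `M = G_γ`
and `F = Φ` its integral over `G ⧸ G_γ` is the orbital integral `∫_{G_γ \ G} Φ(x⁻¹ γ x) dx` of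
Gelbart (1975), (9.13) (left cosets and `y = x⁻¹` here). [cite: Gelbart1975, (9.13)] -/
def descConj {α : Type*} (F : G → α) : G ⧸ M → α := fun y =>
  Quotient.liftOn' y (fun g => F (g * γ₀ * g⁻¹)) fun a b hab => by
    rw [QuotientGroup.leftRel_apply] at hab
    have h := mul_conj_eq_of_commute (g := a) (hM _ hab)
    rw [mul_inv_cancel_left] at h
    rw [h]

/-- `descConj` on classes (definitional). [folklore] -/
@[simp]
theorem descConj_mk {α : Type*} (F : G → α) (g : G) :
    descConj γ₀ M hM F (QuotientGroup.mk g) = F (g * γ₀ * g⁻¹) :=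
  rfl

/-- The lift of `descConj F` to `G` is `g ↦ F(g γ₀ g⁻¹)`. [folklore] -/
theorem descConj_comp_mk {α : Type*} (F : G → α) :
    descConj γ₀ M hM F ∘ (QuotientGroup.mk : G → G ⧸ M) = fun g => F (g * γ₀ * g⁻¹) :=
  rfl

/-- `descConj F = F ∘ (y M ↦ y γ₀ y⁻¹)`. [folklore] -/
theorem descConj_eq_comp {α : Type*} (F : G → α) :
    descConj γ₀ M hM F = F ∘ descConj γ₀ M hM id := by
  funext y
  induction y using QuotientGroup.induction_on
  rfl

/-- `descConj` commutes with post-composition: `descConj (φ ∘ F) = φ ∘ descConj F`. [folklore] -/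
theorem descConj_comp {α β : Type*} (φ : α → β) (F : G → α) :
    descConj γ₀ M hM (φ ∘ F) = φ ∘ descConj γ₀ M hM F := by
  funext y
  induction y using QuotientGroup.induction_on
  rfl

/-- **Compatibility with `G ⧸ M → G ⧸ N`** (`M ≤ N` both centralising `γ₀`): the orbital
integrand on `G ⧸ M` is the pull-back of the one on `G ⧸ N`. [folklore] -/
theorem descConj_comp_quotientMapOfLE (N : Subgroup G) (hN : ∀ n ∈ N, n * γ₀ = γ₀ * n)
    (hMN : M ≤ N) {α : Type*} (F : G → α) :
    descConj γ₀ N hN F ∘ Subgroup.quotientMapOfLE hMN = descConj γ₀ M hM F := by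
  funext y
  induction y using QuotientGroup.induction_on
  rfl

variable [TopologicalSpace G] [IsTopologicalGroup G]

/-- The orbital integrand of a continuous `F` is continuous. [folklore] -/
theorem continuous_descConj {α : Type*} [TopologicalSpace α] {F : G → α} (hF : Continuous F) :
    Continuous (descConj γ₀ M hM F) := by
  rw [← QuotientGroup.isOpenQuotientMap_mk.continuous_comp_iff, descConj_comp_mk]
  fun_prop

/-- The orbital integrand of a Borel `F` is Borel (it is `F` composed with the continuous map
`y M ↦ y γ₀ y⁻¹`). [folklore] -/
theorem measurable_descConj [MeasurableSpace G] [BorelSpace G] [MeasurableSpace (G ⧸ M)]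
    [BorelSpace (G ⧸ M)] {α : Type*} [MeasurableSpace α] {F : G → α} (hF : Measurable F) :
    Measurable (descConj γ₀ M hM F) := by
  rw [descConj_eq_comp]
  exact hF.comp (continuous_descConj γ₀ M hM continuous_id).measurable

end DescConj

/-! ### The diagonal kernel: descent of `x ↦ Σ_{s ∈ S} F(x s x⁻¹)` to `G ⧸ L` -/

section ConjTsum

variable {G : Type*} [Group G] (L : Subgroup G) (S : Set G)
  (hS : ∀ ℓ ∈ L, ∀ s ∈ S, ℓ * s * ℓ⁻¹ ∈ S)

/-- **The sum over conjugates** `conjTsum L S _ F : G ⧸ L → α`,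
`x L ↦ Σ'_{s ∈ S} F(x s x⁻¹)` (unconditional sum `tsum` in a commutative topological additive
monoid `α`: `[0, ∞]`, or `ℝ`, `ℂ` where it is the sum when summable and `0` otherwise), for a set
`S ⊆ G` stable under conjugation by `L` (well defined: conjugation by `ℓ ∈ L` permutes `S`). For
`S = Γ = G(K)`, `L = A_G · G(K)` and
`F = Φ_A = ∫_{A_G} Φ(a⁻¹ ·)` this is (a constant multiple of) the kernel of `R(Φ)` on the diagonal,
`K_Φ(x, x) = Σ_{γ ∈ G(K)} Φ_A(x γ x⁻¹)` (Gelbart (1975), (9.12);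
`AdelicGroupData.quotientKernel_mk_mk_eq_smul_tsum_integral`). [cite: Gelbart1975, (9.12)] -/
def conjTsum {α : Type*} [AddCommMonoid α] [TopologicalSpace α] (F : G → α) : G ⧸ L → α :=
  fun x => Quotient.liftOn' x (fun g => ∑' s : S, F (g * s * g⁻¹)) fun a b hab => by
    rw [QuotientGroup.leftRel_apply] at hab
    have hiff : ∀ s : G, s ∈ S ↔ (MulAut.conj (a⁻¹ * b)).toEquiv s ∈ S := fun s =>
      ⟨fun hs => hS _ hab s hs, fun hs => by
        have h2 := hS _ (L.inv_mem hab) _ hs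
        change (a⁻¹ * b)⁻¹ * (a⁻¹ * b * s * (a⁻¹ * b)⁻¹) * (a⁻¹ * b)⁻¹⁻¹ ∈ S at h2
        rwa [show (a⁻¹ * b)⁻¹ * (a⁻¹ * b * s * (a⁻¹ * b)⁻¹) * (a⁻¹ * b)⁻¹⁻¹ = s by group] at h2⟩
    symm
    calc ∑' s : S, F (b * s * b⁻¹)
        = ∑' s : S, F (a * ((MulAut.conj (a⁻¹ * b)).toEquiv.subtypeEquiv hiff s : G) * a⁻¹) := by
          refine tsum_congr fun s => ?_
          congr 1
          change b * s * b⁻¹ = a * (a⁻¹ * b * s * (a⁻¹ * b)⁻¹) * a⁻¹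
          group
      _ = ∑' s : S, F (a * s * a⁻¹) :=
          ((MulAut.conj (a⁻¹ * b)).toEquiv.subtypeEquiv hiff).tsum_eq fun s : S => F (a * s * a⁻¹)

/-- `conjTsum` on classes (definitional). [folklore] -/
@[simp]
theorem conjTsum_mk {α : Type*} [AddCommMonoid α] [TopologicalSpace α] (F : G → α) (g : G) :
    conjTsum L S hS F (QuotientGroup.mk g) = ∑' s : S, F (g * s * g⁻¹) :=
  rfl

/-- `conjTsum` for `S = Γ` a subgroup, summed over `Γ` (definitional). [folklore] -/
theorem conjTsum_coe_mk (Γ : Subgroup G) (hΓ : ∀ ℓ ∈ L, ∀ s ∈ (Γ : Set G), ℓ * s * ℓ⁻¹ ∈ (Γ : Set G))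
    {α : Type*} [AddCommMonoid α] [TopologicalSpace α] (F : G → α) (g : G) :
    conjTsum L (Γ : Set G) hΓ F (QuotientGroup.mk g) = ∑' γ : Γ, F (g * γ * g⁻¹) :=
  rfl

/-- `conjTsum` is monotone in `F ≥ 0`. [folklore] -/
theorem conjTsum_mono {F F' : G → ℝ≥0∞} (h : ∀ g, F g ≤ F' g) (x : G ⧸ L) :
    conjTsum L S hS F x ≤ conjTsum L S hS F' x := by
  induction x using QuotientGroup.induction_on with
  | H g =>
    simp only [conjTsum_mk]
    exact ENNReal.tsum_le_tsum fun s => h _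

/-- **A real sum over conjugates is the difference of the sums of the positive and negative
parts** where it converges absolutely: for `F : G → ℝ` and `g` with
`Σ'_{s} ‖F(g s g⁻¹)‖ₑ < ∞`,
`Σ'_s F(g s g⁻¹) = (Σ'_s F(g s g⁻¹)⁺) - (Σ'_s F(g s g⁻¹)⁻)` (sums in `[0, ∞]` converted by
`toReal`). [folklore] -/
theorem conjTsum_real_eq_toReal_sub (F : G → ℝ) (g : G)
    (hfin : conjTsum L S hS (fun x => ‖F x‖ₑ) (QuotientGroup.mk g) < ∞) :
    conjTsum L S hS F (QuotientGroup.mk g) =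
      (conjTsum L S hS (fun x => ENNReal.ofReal (F x)) (QuotientGroup.mk g)).toReal -
        (conjTsum L S hS (fun x => ENNReal.ofReal (-F x)) (QuotientGroup.mk g)).toReal := by
  simp only [conjTsum_mk] at hfin ⊢
  have hsum : Summable fun s : S => ‖F (g * s * g⁻¹)‖ := by
    have := ENNReal.summable_toReal hfin.ne
    simpa only [toReal_enorm] using this
  have hpos : Summable fun s : S => max (F (g * s * g⁻¹)) 0 :=
    hsum.of_nonneg_of_le (fun s => le_max_right _ _) fun s =>
      max_le ((le_abs_self _).trans_eq (Real.norm_eq_abs _).symm) (norm_nonneg _)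
  have hneg : Summable fun s : S => max (-F (g * s * g⁻¹)) 0 :=
    hsum.of_nonneg_of_le (fun s => le_max_right _ _) fun s =>
      max_le ((neg_le_abs _).trans_eq (Real.norm_eq_abs _).symm) (norm_nonneg _)
  rw [ENNReal.tsum_toReal_eq (fun s => ENNReal.ofReal_ne_top),
    ENNReal.tsum_toReal_eq (fun s => ENNReal.ofReal_ne_top)]
  simp only [ENNReal.toReal_ofReal']
  rw [← hpos.tsum_sub hneg]
  exact tsum_congr fun s => (max_zero_sub_max_neg_zero_eq_self _).symm

variable [TopologicalSpace G] [IsTopologicalGroup G] [LocallyCompactSpace G]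
  [SecondCountableTopology G] [T2Space G] [MeasurableSpace G] [BorelSpace G]
  [MeasurableSpace (G ⧸ L)] [BorelSpace (G ⧸ L)]

/-- **The sum over conjugates of a Borel `F` is Borel** on `G ⧸ L` for `L` closed and `S`
countable: its lift to `G` is a countable sum of Borel functions, and measurability descends to the
coset space of a closed subgroup (`measurable_quotient_iff`). [folklore] -/
theorem measurable_conjTsum (hL : IsClosed (L : Set G)) [Countable S] {F : G → ℝ≥0∞}
    (hF : Measurable F) : Measurable (conjTsum L S hS F) := by
  rw [measurable_quotient_iff hL]
  change Measurable fun g : G => ∑' s : S, F (g * s * g⁻¹)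
  simp_rw [ENNReal.tsum_eq_iSup_sum]
  refine Measurable.iSup fun t => Finset.measurable_fun_sum t fun s _ => ?_
  exact hF.comp (by fun_prop : Measurable fun g : G => g * (s : G) * g⁻¹)

end ConjTsum

/-! ### `Σ_{γ ∈ Γ} = Σ_{[γ]} Σ_{s ∈ [γ]}` -/

section Classes

variable {G : Type*} [Group G] (Γ : Subgroup G)

/-- `ConjClasses Γ` is countable for countable `Γ`. [folklore] -/
theorem countable_conjClasses [Countable Γ] : Countable (ConjClasses Γ) :=
  ConjClasses.mk_surjective.countable

/-- **The fibre of `ConjClasses.mk` over `[γ₀]` is the conjugacy class of `γ₀`**, as a subset of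
`G`: `γ ↦ (γ : G)` is a bijection `{γ : Γ // [γ] = c} ≃ conjOrbit Γ (rep c)`. [folklore] -/
theorem bijective_fibre_conjOrbit (rep : ConjClasses Γ → Γ) (hrep : ∀ c, ConjClasses.mk (rep c) = c)
    (c : ConjClasses Γ) :
    ∃ e : {γ : Γ // ConjClasses.mk γ = c} ≃ conjOrbit Γ (rep c : G), ∀ γ, (e γ : G) = (γ.1 : G) := by
  have hmem : ∀ γ : {γ : Γ // ConjClasses.mk γ = c}, ((γ.1 : Γ) : G) ∈ conjOrbit Γ (rep c : G) := by
    rintro ⟨γ, hγ⟩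
    rw [← hrep c, ConjClasses.mk_eq_mk_iff_isConj] at hγ
    obtain ⟨δ, hδ⟩ := isConj_iff.1 hγ
    refine (mem_conjOrbit_iff Γ).2 ⟨((δ⁻¹ : Γ) : G), (δ⁻¹).2, ?_⟩
    rw [← hδ]
    push_cast
    group
  refine ⟨Equiv.ofBijective (fun γ => (⟨_, hmem γ⟩ : conjOrbit Γ (rep c : G))) ⟨?_, ?_⟩,
    fun γ => rfl⟩
  · intro γ γ' h
    have h1 := congrArg Subtype.val h
    exact Subtype.ext (Subtype.ext h1)
  · rintro ⟨s, hs⟩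
    obtain ⟨δ, hδ, rfl⟩ := (mem_conjOrbit_iff Γ).1 hs
    refine ⟨⟨⟨δ, hδ⟩ * rep c * ⟨δ, hδ⟩⁻¹, ?_⟩, ?_⟩
    · conv_rhs => rw [← hrep c]
      rw [ConjClasses.mk_eq_mk_iff_isConj]
      refine (isConj_iff.2 ?_).symm
      exact ⟨⟨δ, hδ⟩, rfl⟩
    · rfl

/-- **Rearranging the sum over `Γ` by conjugacy classes**: for `f : G → [0, ∞]` and
representatives `rep [γ] ∈ [γ]`, `Σ'_{γ ∈ Γ} f γ = Σ'_{c} Σ'_{s ∈ conjOrbit Γ (rep c)} f s`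
(unconditional sums in `[0, ∞]`; Gelbart (1975), (9.12) ⟶ (9.13)). [cite: Gelbart1975, (9.13)] -/
theorem tsum_subgroup_eq_tsum_conjOrbit (rep : ConjClasses Γ → Γ)
    (hrep : ∀ c, ConjClasses.mk (rep c) = c) (f : G → ℝ≥0∞) :
    ∑' γ : Γ, f γ = ∑' c : ConjClasses Γ, ∑' s : conjOrbit Γ (rep c : G), f s := by
  rw [← (Equiv.sigmaFiberEquiv (@ConjClasses.mk Γ _)).tsum_eq (fun γ : Γ => f γ),
    ENNReal.tsum_sigma']
  refine tsum_congr fun c => ?_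
  obtain ⟨e, he⟩ := bijective_fibre_conjOrbit Γ rep hrep c
  rw [← e.tsum_eq]
  refine tsum_congr fun γ => ?_
  rw [Equiv.sigmaFiberEquiv_apply, he]

variable (L : Subgroup G)

/-- **The diagonal kernel is the sum of its class contributions**:
`conjTsum L Γ F = Σ'_{c} conjTsum L (conjOrbit Γ (rep c)) F`. [cite: Gelbart1975, (9.13)] -/
theorem conjTsum_subgroup_eq_tsum_conjOrbit
    (hLΓ : ∀ ℓ ∈ L, ∃ γ ∈ Γ, γ⁻¹ * ℓ ∈ Subgroup.centralizer (Γ : Set G))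
    (rep : ConjClasses Γ → Γ) (hrep : ∀ c, ConjClasses.mk (rep c) = c) (F : G → ℝ≥0∞)
    (x : G ⧸ L) :
    conjTsum L (Γ : Set G) (conj_mem_subgroup_of_exists Γ L hLΓ) F x =
      ∑' c : ConjClasses Γ, conjTsum L (conjOrbit Γ (rep c : G))
        (conj_mem_conjOrbit_of_exists Γ L hLΓ (rep c).2) F x := by
  induction x using QuotientGroup.induction_on with
  | H g =>
    simp only [conjTsum_mk]
    exact tsum_subgroup_eq_tsum_conjOrbit Γ rep hrep fun s => F (g * s * g⁻¹)

end Classes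

/-! ### One conjugacy class: the fibre of `G ⧸ H_γ → G ⧸ L` is the class of `γ` -/

section OneClass

variable {G : Type*} [Group G] (Γ L : Subgroup G) (hΓL : Γ ≤ L)
  (hLΓ : ∀ ℓ ∈ L, ∃ γ ∈ Γ, γ⁻¹ * ℓ ∈ Subgroup.centralizer (Γ : Set G))
  {γ₀ : G} (hγ₀ : γ₀ ∈ Γ) (H₀ : Subgroup G) (hH₀ : ∀ g, g ∈ H₀ ↔ g ∈ L ∧ g * γ₀ = γ₀ * g)

include hH₀ in
/-- `H_γ = L ∩ C_G(γ) ≤ L`. [folklore] -/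
theorem le_of_mem_iff : H₀ ≤ L := fun g hg => ((hH₀ g).1 hg).1

include hH₀ in
/-- `H_γ = L ∩ C_G(γ)` centralises `γ`. [folklore] -/
theorem commute_of_mem_iff : ∀ m ∈ H₀, m * γ₀ = γ₀ * m := fun g hg => ((hH₀ g).1 hg).2

include hH₀ in
/-- `H_γ = L ∩ C_G(γ)` is closed when `L` is (`G` Hausdorff). [folklore] -/
theorem isClosed_of_mem_iff [TopologicalSpace G] [IsTopologicalGroup G] [T2Space G]
    (hL : IsClosed (L : Set G)) : IsClosed (H₀ : Set G) := by
  have h : (H₀ : Set G) = (L : Set G) ∩ {g : G | g * γ₀ = γ₀ * g} :=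
    Set.ext fun g => hH₀ g
  rw [h]
  exact hL.inter (isClosed_eq (continuous_id.mul continuous_const)
    (continuous_const.mul continuous_id))

include hΓL hLΓ hγ₀ hH₀ in
/-- **The fibre of `G ⧸ H_γ → G ⧸ L` over the base point is the conjugacy class of `γ`**: the map
`ℓ H_γ ↦ ℓ γ ℓ⁻¹` is a bijection `L ⧸ (H_γ ⊓ L) ≃ conjOrbit Γ γ` (well defined and injective since
`H_γ = L ∩ C_G(γ)`; into the class since `L = Γ · C_L(Γ)`; onto since `Γ ≤ L`) — the
identification `Γ(γ)\Γ ↔ {δ⁻¹ γ δ}` of Gelbart (1975), (9.13). [cite: Gelbart1975, (9.13)] -/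
theorem exists_equiv_quotient_conjOrbit :
    ∃ θ : L ⧸ H₀.subgroupOf L ≃ conjOrbit Γ γ₀,
      ∀ ℓ : L, (θ (QuotientGroup.mk ℓ) : G) = (ℓ : G) * γ₀ * (ℓ : G)⁻¹ := by
  -- the map on representatives lands in the class
  have hmem : ∀ ℓ : L, (ℓ : G) * γ₀ * (ℓ : G)⁻¹ ∈ conjOrbit Γ γ₀ := fun ℓ =>
    conj_mem_conjOrbit_of_exists Γ L hLΓ hγ₀ ℓ ℓ.2 γ₀ (self_mem_conjOrbit Γ γ₀)
  -- it is constant on cosets of `H_γ ⊓ L`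
  have hwd : ∀ a b : L, (QuotientGroup.leftRel (H₀.subgroupOf L)) a b →
      (⟨_, hmem a⟩ : conjOrbit Γ γ₀) = ⟨_, hmem b⟩ := by
    intro a b hab
    rw [QuotientGroup.leftRel_apply, Subgroup.mem_subgroupOf] at hab
    refine Subtype.ext ?_
    change (a : G) * γ₀ * (a : G)⁻¹ = (b : G) * γ₀ * (b : G)⁻¹
    have h := mul_conj_eq_of_commute (g := (a : G)) (commute_of_mem_iff L H₀ hH₀ _ hab)
    rw [Subgroup.coe_mul, InvMemClass.coe_inv, mul_inv_cancel_left] at h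
    exact h.symm
  set θ : L ⧸ H₀.subgroupOf L → conjOrbit Γ γ₀ := fun z => Quotient.liftOn' z _ hwd with hθ
  have hθmk : ∀ ℓ : L, θ (QuotientGroup.mk ℓ) = ⟨_, hmem ℓ⟩ := fun ℓ => rfl
  refine ⟨Equiv.ofBijective θ ⟨?_, ?_⟩, fun ℓ => by
    rw [Equiv.ofBijective_apply, hθmk]⟩
  · intro z z' hzz'
    induction z using QuotientGroup.induction_on with
    | H ℓ =>
      induction z' using QuotientGroup.induction_on with
      | H ℓ' =>
        rw [hθmk, hθmk, Subtype.ext_iff] at hzz'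
        change (ℓ : G) * γ₀ * (ℓ : G)⁻¹ = (ℓ' : G) * γ₀ * (ℓ' : G)⁻¹ at hzz'
        refine QuotientGroup.eq.2 ?_
        rw [Subgroup.mem_subgroupOf, hH₀]
        exact ⟨(ℓ⁻¹ * ℓ').2, by
          rw [Subgroup.coe_mul, InvMemClass.coe_inv]
          exact inv_mul_commute_of_conj_eq hzz'⟩
  · rintro ⟨s, hs⟩
    obtain ⟨δ, hδ, rfl⟩ := (mem_conjOrbit_iff Γ).1 hs
    exact ⟨QuotientGroup.mk ⟨δ, hΓL hδ⟩, by rw [hθmk]⟩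

include hΓL hLΓ hγ₀ hH₀ in
/-- **The fibre sum over `L ⧸ H_γ` of the orbital integrand is the class sum**: for `g ∈ G`,
`Σ'_{z ∈ L ⧸ H_γ⊓L} F((g ℓ_z) γ (g ℓ_z)⁻¹) = Σ'_{s ∈ conjOrbit Γ γ} F(g s g⁻¹)`
(reindex by `exists_equiv_quotient_conjOrbit`). [cite: Gelbart1975, (9.13)] -/
theorem tsum_descConj_smul_inclQuot_eq (F : G → ℝ≥0∞) (g : G) :
    ∑' z : L ⧸ H₀.subgroupOf L,
        descConj γ₀ H₀ (commute_of_mem_iff L H₀ hH₀) F (g • inclQuot H₀ L z) =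
      ∑' s : conjOrbit Γ γ₀, F (g * s * g⁻¹) := by
  obtain ⟨θ, hθ⟩ := exists_equiv_quotient_conjOrbit Γ L hΓL hLΓ hγ₀ H₀ hH₀
  rw [← θ.tsum_eq]
  refine tsum_congr fun z => ?_
  induction z using QuotientGroup.induction_on with
  | H ℓ =>
    rw [hθ, inclQuot_mk, MulAction.Quotient.smul_mk, smul_eq_mul, descConj_mk]
    congr 1
    group

end OneClass

/-! ### One conjugacy class: the measure identity -/

section OneClassMeasure

variable {G : Type*} [Group G] [TopologicalSpace G] [IsTopologicalGroup G] [LocallyCompactSpace G]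
  [SecondCountableTopology G] [T2Space G] [MeasurableSpace G] [BorelSpace G]
  (Γ L : Subgroup G) [hL : IsClosed (L : Set G)] (hΓL : Γ ≤ L)
  (hLΓ : ∀ ℓ ∈ L, ∃ γ ∈ Γ, γ⁻¹ * ℓ ∈ Subgroup.centralizer (Γ : Set G))
  {γ₀ : G} (hγ₀ : γ₀ ∈ Γ) (H₀ G₀ : Subgroup G)
  (hH₀ : ∀ g, g ∈ H₀ ↔ g ∈ L ∧ g * γ₀ = γ₀ * g) (hHG : H₀ ≤ G₀)
  (hG₀ : ∀ g ∈ G₀, g * γ₀ = γ₀ * g) [hG₀c : IsClosed (G₀ : Set G)]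
  [MeasurableSpace (G ⧸ L)] [BorelSpace (G ⧸ L)] [MeasurableSpace (G ⧸ H₀)] [BorelSpace (G ⧸ H₀)]
  [MeasurableSpace (G ⧸ G₀)] [BorelSpace (G ⧸ G₀)]
  (μ : Measure (G ⧸ L)) [SMulInvariantMeasure G (G ⧸ L) μ] [IsFiniteMeasureOnCompacts μ]
  (μH : Measure (G ⧸ H₀)) [SMulInvariantMeasure G (G ⧸ H₀) μH] [IsFiniteMeasureOnCompacts μH]
  (μC : Measure (G ⧸ G₀)) [SMulInvariantMeasure G (G ⧸ G₀) μC] [IsFiniteMeasureOnCompacts μC]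

include hΓL hH₀ hHG in
/-- **The contribution of one conjugacy class** (Gelbart (1975), (9.13), Remark 9.23:
`∫_{Γ(γ)A\G} Φ_A(x⁻¹γx) dx = vol · ∫_{G_γ\G} Φ_A(x⁻¹γx) dx`). Let `Γ ≤ L ≤ G` with `L` closed
and `L = Γ · C_L(Γ)`, `γ ∈ Γ`, `H_γ = L ∩ C_G(γ)` relatively open in `L`, `G_γ ⊇ H_γ` a closed
subgroup centralising `γ` with `G_γ ⧸ H_γ` compact, and `μ`, `μ_γ^H`, `μ_γ` non-zero `G`-invariant
Borel measures finite on compact sets on `G ⧸ L`, `G ⧸ H_γ`, `G ⧸ G_γ`. Then there is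
`d ∈ (0, ∞)` with
`∫_{G ⧸ L} Σ'_{s ∈ [γ]} F(x s x⁻¹) dμ(x) = d ∫_{G ⧸ G_γ} F(y γ y⁻¹) dμ_γ(y)` for every Borel
`F : G → [0, ∞]`: integrate the orbital integrand on `G ⧸ H_γ` in stages in the two ways
`G ⧸ H_γ → G ⧸ L` (discrete fibre = the class of `γ`, `exists_lintegral_eq_mul_lintegral_tsum`)
and `G ⧸ H_γ → G ⧸ G_γ` (compact fibre, `exists_lintegral_comp_quotientMapOfLE_eq_mul_lintegral`).
[cite: Gelbart1975, (9.13) and Remark 9.23] -/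
theorem exists_lintegral_conjTsum_conjOrbit_eq
    (hopen : IsOpen ((H₀.subgroupOf L : Subgroup L) : Set L))
    [CompactSpace (G₀ ⧸ H₀.subgroupOf G₀)] (hμ : μ ≠ 0) (hμH : μH ≠ 0) (hμC : μC ≠ 0) :
    ∃ d : ℝ≥0∞, d ≠ 0 ∧ d ≠ ∞ ∧ ∀ F : G → ℝ≥0∞, Measurable F →
      ∫⁻ x, conjTsum L (conjOrbit Γ γ₀) (conj_mem_conjOrbit_of_exists Γ L hLΓ hγ₀) F x ∂μ =
        d * ∫⁻ y, descConj γ₀ G₀ hG₀ F y ∂μC := by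
  haveI : IsClosed (H₀ : Set G) := isClosed_of_mem_iff L H₀ hH₀ hL
  letI : MeasurableSpace (L ⧸ H₀.subgroupOf L) := borel _
  haveI : BorelSpace (L ⧸ H₀.subgroupOf L) := ⟨rfl⟩
  have hH₀L : H₀ ≤ L := le_of_mem_iff L H₀ hH₀
  -- down to `G ⧸ L`: discrete fibre
  obtain ⟨c, hc0, hct, hc⟩ :=
    exists_lintegral_eq_mul_lintegral_tsum H₀ L μH μ hH₀L hopen hμH hμ
  -- down to `G ⧸ G_γ`: compact fibre
  obtain ⟨v, hv0, hvt, hv⟩ :=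
    exists_lintegral_comp_quotientMapOfLE_eq_mul_lintegral H₀ G₀ μH μC hHG hμH hμC
  refine ⟨c⁻¹ * v, mul_ne_zero (ENNReal.inv_ne_zero.2 hct) hv0,
    ENNReal.mul_ne_top (ENNReal.inv_ne_top.2 hc0) hvt, fun F hF => ?_⟩
  set f : G ⧸ H₀ → ℝ≥0∞ := descConj γ₀ H₀ (commute_of_mem_iff L H₀ hH₀) F with hf
  have hfm : Measurable f := measurable_descConj γ₀ H₀ _ hF
  -- the two evaluations of `∫ f dμ_γ^H`
  have h1 := hc f hfm
  have h2 : ∫⁻ x, f x ∂μH = v * ∫⁻ y, descConj γ₀ G₀ hG₀ F y ∂μC := by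
    rw [← hv _ (measurable_descConj γ₀ G₀ hG₀ hF)]
    simp_rw [hf, ← descConj_comp_quotientMapOfLE γ₀ H₀ (commute_of_mem_iff L H₀ hH₀) G₀ hG₀ hHG F,
      Function.comp_apply]
  -- the fibre sum is the class sum
  have h3 : ∀ y : G ⧸ L, ∑' z : L ⧸ H₀.subgroupOf L, f ((y.out : G) • inclQuot H₀ L z) =
      conjTsum L (conjOrbit Γ γ₀) (conj_mem_conjOrbit_of_exists Γ L hLΓ hγ₀) F y := by
    intro y
    conv_rhs => rw [← QuotientGroup.out_eq' y, conjTsum_mk]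
    exact tsum_descConj_smul_inclQuot_eq Γ L hΓL hLΓ hγ₀ H₀ hH₀ F y.out
  calc ∫⁻ x, conjTsum L (conjOrbit Γ γ₀) (conj_mem_conjOrbit_of_exists Γ L hLΓ hγ₀) F x ∂μ
      = ∫⁻ y, ∑' z : L ⧸ H₀.subgroupOf L, f ((y.out : G) • inclQuot H₀ L z) ∂μ :=
        lintegral_congr fun y => (h3 y).symm
    _ = c⁻¹ * (c * ∫⁻ y, ∑' z : L ⧸ H₀.subgroupOf L, f ((y.out : G) • inclQuot H₀ L z) ∂μ) := by
        rw [← mul_assoc, ENNReal.inv_mul_cancel hc0 hct, one_mul]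
    _ = c⁻¹ * ∫⁻ x, f x ∂μH := by rw [← h1]
    _ = c⁻¹ * (v * ∫⁻ y, descConj γ₀ G₀ hG₀ F y ∂μC) := by rw [h2]
    _ = c⁻¹ * v * ∫⁻ y, descConj γ₀ G₀ hG₀ F y ∂μC := by rw [mul_assoc]

end OneClassMeasure

/-! ### The geometric side: sum over all conjugacy classes -/

section Assembly

variable {G : Type*} [Group G] [TopologicalSpace G] [IsTopologicalGroup G] [LocallyCompactSpace G]
  [SecondCountableTopology G] [T2Space G] [MeasurableSpace G] [BorelSpace G]
  (Γ L : Subgroup G) [hL : IsClosed (L : Set G)] [Countable Γ] (hΓL : Γ ≤ L)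
  (hLΓ : ∀ ℓ ∈ L, ∃ γ ∈ Γ, γ⁻¹ * ℓ ∈ Subgroup.centralizer (Γ : Set G))
  (rep : ConjClasses Γ → Γ) (hrep : ∀ c, ConjClasses.mk (rep c) = c)
  (Hc Gc : ConjClasses Γ → Subgroup G)
  (hHc : ∀ c g, g ∈ Hc c ↔ g ∈ L ∧ g * (rep c : G) = (rep c : G) * g)
  (hHG : ∀ c, Hc c ≤ Gc c) (hGc : ∀ c, ∀ g ∈ Gc c, g * (rep c : G) = (rep c : G) * g)
  [hGcl : ∀ c, IsClosed ((Gc c : Subgroup G) : Set G)]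
  [MeasurableSpace (G ⧸ L)] [BorelSpace (G ⧸ L)]
  [∀ c, MeasurableSpace (G ⧸ Hc c)] [∀ c, BorelSpace (G ⧸ Hc c)]
  [∀ c, MeasurableSpace (G ⧸ Gc c)] [∀ c, BorelSpace (G ⧸ Gc c)]
  (μ : Measure (G ⧸ L)) [SMulInvariantMeasure G (G ⧸ L) μ] [IsFiniteMeasureOnCompacts μ]
  (μH : ∀ c, Measure (G ⧸ Hc c)) [∀ c, SMulInvariantMeasure G (G ⧸ Hc c) (μH c)]
  [∀ c, IsFiniteMeasureOnCompacts (μH c)]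
  (μC : ∀ c, Measure (G ⧸ Gc c)) [∀ c, SMulInvariantMeasure G (G ⧸ Gc c) (μC c)]
  [∀ c, IsFiniteMeasureOnCompacts (μC c)]

include hΓL hrep hHc hHG in
/-- **The geometric side of the trace formula for a compact quotient, class by class** (Gelbart
(1975), (9.13): `tr R₀^λ(φ) = Σ_{[γ]} vol(Γ(γ)\G_γ) ∫_{G_γ\G} φ(x⁻¹ γ x) dx`; Remark 9.23 and (10.14)
for a division quaternion algebra, with `Z_∞^+ G_ℚ` in place of `Γ`). Let `G` be a locally compact
second countable Hausdorff group, `Γ ≤ L ≤ G` with `L` closed, `Γ` countable and `L = Γ · C_L(Γ)`;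
for each conjugacy class `c` of `Γ` fix a representative `rep c`, the subgroup
`H_c = L ∩ C_G(rep c)` (assumed relatively open in `L`) and a closed subgroup `G_c ⊇ H_c`
centralising `rep c` with `G_c ⧸ H_c` compact, and non-zero `G`-invariant Borel measures finite on
compact sets `μ` on `G ⧸ L`, `μ_c^H` on `G ⧸ H_c`, `μ_c` on `G ⧸ G_c`. Then there are constants
`d_c ∈ (0, ∞)`, independent of `F`, with

  `∫_{G ⧸ L} Σ'_{γ ∈ Γ} F(x γ x⁻¹) dμ(x) = Σ'_c d_c ∫_{G ⧸ G_c} F(y (rep c) y⁻¹) dμ_c(y)`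

for every Borel `F : G → [0, ∞]` (split the sum over `Γ` into classes,
`conjTsum_subgroup_eq_tsum_conjOrbit`, exchange with the integral, and apply
`exists_lintegral_conjTsum_conjOrbit_eq` to each class). CAVEAT: the printed constants are the
volumes `vol(Γ(γ) A \ G_γ)`; here `d_c` is only shown to lie in `(0, ∞)` — do not read it as a
volume without a further normalisation argument. [cite: Gelbart1975, (9.13) and Remark 9.23] -/
theorem exists_lintegral_conjTsum_eq_tsum
    (hopen : ∀ c, IsOpen (((Hc c).subgroupOf L : Subgroup L) : Set L))
    [∀ c, CompactSpace (Gc c ⧸ (Hc c).subgroupOf (Gc c))]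
    (hμ : μ ≠ 0) (hμH : ∀ c, μH c ≠ 0) (hμC : ∀ c, μC c ≠ 0) :
    ∃ d : ConjClasses Γ → ℝ≥0∞, (∀ c, d c ≠ 0 ∧ d c ≠ ∞) ∧ ∀ F : G → ℝ≥0∞, Measurable F →
      ∫⁻ x, conjTsum L (Γ : Set G) (conj_mem_subgroup_of_exists Γ L hLΓ) F x ∂μ =
        ∑' c, d c * ∫⁻ y, descConj (rep c : G) (Gc c) (hGc c) F y ∂(μC c) := by
  have key := fun c => exists_lintegral_conjTsum_conjOrbit_eq Γ L hΓL hLΓ (rep c).2 (Hc c) (Gc c)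
    (hHc c) (hHG c) (hGc c) μ (μH c) (μC c) (hopen c) hμ (hμH c) (hμC c)
  choose d hd0 hdt hd using key
  refine ⟨d, fun c => ⟨hd0 c, hdt c⟩, fun F hF => ?_⟩
  haveI := countable_conjClasses Γ
  have h1 : ∀ x, conjTsum L (Γ : Set G) (conj_mem_subgroup_of_exists Γ L hLΓ) F x =
      ∑' c, conjTsum L (conjOrbit Γ (rep c : G))
        (conj_mem_conjOrbit_of_exists Γ L hLΓ (rep c).2) F x :=
    conjTsum_subgroup_eq_tsum_conjOrbit Γ L hLΓ rep hrep F
  simp_rw [h1]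
  rw [lintegral_tsum fun c => ?_]
  · exact tsum_congr fun c => hd c F hF
  · haveI := countable_conjOrbit Γ (rep c : G)
    exact (measurable_conjTsum L _ _ hL hF).aemeasurable

end Assembly

/-! ### From `[0, ∞]` to real integrands: the geometric side for integrable `F` -/

section Integral

variable {G : Type*} [Group G] [TopologicalSpace G] [IsTopologicalGroup G] [LocallyCompactSpace G]
  [SecondCountableTopology G] [T2Space G] [MeasurableSpace G] [BorelSpace G]
  (L : Subgroup G) [hL : IsClosed (L : Set G)] (S : Set G) [Countable S]
  (hS : ∀ ℓ ∈ L, ∀ s ∈ S, ℓ * s * ℓ⁻¹ ∈ S)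
  [MeasurableSpace (G ⧸ L)] [BorelSpace (G ⧸ L)] (μ : Measure (G ⧸ L))
  {ι : Type*} (γ : ι → G) (M : ι → Subgroup G) (hM : ∀ i, ∀ m ∈ M i, m * γ i = γ i * m)
  [∀ i, MeasurableSpace (G ⧸ M i)] [∀ i, BorelSpace (G ⧸ M i)] (ν : ∀ i, Measure (G ⧸ M i))
  {d : ι → ℝ≥0∞}

/-- **The geometric side for real integrands.** Suppose the `[0, ∞]`-valued identity
`∫_{G ⧸ L} Σ'_{s ∈ S} F(x s x⁻¹) dμ = Σ'_i d_i ∫_{G ⧸ M_i} F(y γ_i y⁻¹) dν_i` holds for all Borel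
`F ≥ 0` with constants `d_i ≠ 0` (as produced by `exists_lintegral_conjTsum_eq_tsum` or
`exists_lintegral_conjTsum_conjOrbit_eq`; the index set need not be countable). Then for every
Borel `F : G → ℝ` with
`∫_{G ⧸ L} Σ'_{s ∈ S} ‖F(x s x⁻¹)‖ dμ < ∞`: the sum over conjugates `conjTsum L S _ F` is
`μ`-integrable, every orbital integrand `y ↦ F(y γ_i y⁻¹)` is `ν_i`-integrable, the right-hand
side converges absolutely, and
`∫_{G ⧸ L} Σ'_{s ∈ S} F(x s x⁻¹) dμ(x) = Σ'_i d_i ∫_{G ⧸ M_i} F(y γ_i y⁻¹) dν_i(y)`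
(apply the hypothesis to `F⁺`, `F⁻` and `|F|`, all finite, and subtract; Gelbart (1975), (9.13),
whose `φ` is a real or complex test function). [cite: Gelbart1975, (9.13) and Remark 9.23] -/
theorem integral_conjTsum_eq_tsum_of_lintegral (hd0 : ∀ i, d i ≠ 0)
    (hId : ∀ F : G → ℝ≥0∞, Measurable F →
      ∫⁻ x, conjTsum L S hS F x ∂μ = ∑' i, d i * ∫⁻ y, descConj (γ i) (M i) (hM i) F y ∂(ν i))
    {F : G → ℝ} (hF : Measurable F)
    (hfin : ∫⁻ x, conjTsum L S hS (fun g => ‖F g‖ₑ) x ∂μ < ∞) :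
    Integrable (conjTsum L S hS F) μ ∧
    (∀ i, Integrable (descConj (γ i) (M i) (hM i) F) (ν i)) ∧
    Summable (fun i => (d i).toReal * ∫ y, ‖descConj (γ i) (M i) (hM i) F y‖ ∂(ν i)) ∧
    ∫ x, conjTsum L S hS F x ∂μ =
      ∑' i, (d i).toReal * ∫ y, descConj (γ i) (M i) (hM i) F y ∂(ν i) := by
  -- positive part, negative part and absolute value, as `[0, ∞]`-valued Borel functions
  set P : G → ℝ≥0∞ := fun g => ENNReal.ofReal (F g) with hP
  set N : G → ℝ≥0∞ := fun g => ENNReal.ofReal (-F g) with hN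
  set A : G → ℝ≥0∞ := fun g => ‖F g‖ₑ with hA
  have hPm : Measurable P := ENNReal.measurable_ofReal.comp hF
  have hNm : Measurable N := ENNReal.measurable_ofReal.comp hF.neg
  have hAm : Measurable A := hF.enorm
  have hPA : ∀ g, P g ≤ A g := fun g => Real.ofReal_le_enorm _
  have hNA : ∀ g, N g ≤ A g := fun g => by
    change ENNReal.ofReal (-F g) ≤ ‖F g‖ₑ
    rw [← enorm_neg]
    exact Real.ofReal_le_enorm _
  -- pointwise descriptions of the orbital integrands of `P`, `N`, `A`
  have hPdesc : ∀ i y, descConj (γ i) (M i) (hM i) P y =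
      ENNReal.ofReal (descConj (γ i) (M i) (hM i) F y) := fun i y => by
    induction y using QuotientGroup.induction_on; rfl
  have hNdesc : ∀ i y, descConj (γ i) (M i) (hM i) N y =
      ENNReal.ofReal (-descConj (γ i) (M i) (hM i) F y) := fun i y => by
    induction y using QuotientGroup.induction_on; rfl
  have hAdesc : ∀ i y, descConj (γ i) (M i) (hM i) A y =
      ‖descConj (γ i) (M i) (hM i) F y‖ₑ := fun i y => by
    induction y using QuotientGroup.induction_on; rfl
  -- finiteness on `G ⧸ L`
  have hmc : ∀ {Φ : G → ℝ≥0∞}, Measurable Φ → Measurable (conjTsum L S hS Φ) := fun hΦ =>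
    measurable_conjTsum L S hS hL hΦ
  have hfinA : ∫⁻ x, conjTsum L S hS A x ∂μ ≠ ∞ := hfin.ne
  have hfinP : ∫⁻ x, conjTsum L S hS P x ∂μ ≠ ∞ :=
    (lt_of_le_of_lt (lintegral_mono fun x => conjTsum_mono L S hS hPA x) hfin).ne
  have hfinN : ∫⁻ x, conjTsum L S hS N x ∂μ ≠ ∞ :=
    (lt_of_le_of_lt (lintegral_mono fun x => conjTsum_mono L S hS hNA x) hfin).ne
  -- the `[0, ∞]` identities and the finiteness of every term
  have hIP := hId P hPm
  have hIN := hId N hNm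
  have hIA := hId A hAm
  have hsP : ∑' i, d i * ∫⁻ y, descConj (γ i) (M i) (hM i) P y ∂(ν i) ≠ ∞ := by
    rw [← hIP]; exact hfinP
  have hsN : ∑' i, d i * ∫⁻ y, descConj (γ i) (M i) (hM i) N y ∂(ν i) ≠ ∞ := by
    rw [← hIN]; exact hfinN
  have hsA : ∑' i, d i * ∫⁻ y, descConj (γ i) (M i) (hM i) A y ∂(ν i) ≠ ∞ := by
    rw [← hIA]; exact hfinA
  have htP : ∀ i, d i * ∫⁻ y, descConj (γ i) (M i) (hM i) P y ∂(ν i) ≠ ∞ := fun i =>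
    ne_top_of_le_ne_top hsP (ENNReal.le_tsum i)
  have htN : ∀ i, d i * ∫⁻ y, descConj (γ i) (M i) (hM i) N y ∂(ν i) ≠ ∞ := fun i =>
    ne_top_of_le_ne_top hsN (ENNReal.le_tsum i)
  have htA : ∀ i, d i * ∫⁻ y, descConj (γ i) (M i) (hM i) A y ∂(ν i) ≠ ∞ := fun i =>
    ne_top_of_le_ne_top hsA (ENNReal.le_tsum i)
  have hfP : ∀ i, ∫⁻ y, descConj (γ i) (M i) (hM i) P y ∂(ν i) ≠ ∞ := fun i h =>
    htP i (by rw [h, ENNReal.mul_top (hd0 i)])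
  have hfN : ∀ i, ∫⁻ y, descConj (γ i) (M i) (hM i) N y ∂(ν i) ≠ ∞ := fun i h =>
    htN i (by rw [h, ENNReal.mul_top (hd0 i)])
  have hfA : ∀ i, ∫⁻ y, descConj (γ i) (M i) (hM i) A y ∂(ν i) ≠ ∞ := fun i h =>
    htA i (by rw [h, ENNReal.mul_top (hd0 i)])
  -- measurability of the orbital integrands
  have hdm : ∀ {Φ : G → ℝ≥0∞}, Measurable Φ → ∀ i, Measurable (descConj (γ i) (M i) (hM i) Φ) :=
    fun hΦ i => measurable_descConj _ _ _ hΦ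
  have hdF : ∀ i, Measurable (descConj (γ i) (M i) (hM i) F) := fun i =>
    measurable_descConj _ _ _ hF
  -- integrability and integrals of the orbital integrands
  have hposI : ∀ i, Integrable (fun y => max (descConj (γ i) (M i) (hM i) F y) 0) (ν i) := by
    intro i
    refine (integrable_toReal_of_lintegral_ne_top (hdm hPm i).aemeasurable (hfP i)).congr
      (Eventually.of_forall fun y => ?_)
    simp only [hPdesc i y, ENNReal.toReal_ofReal']
  have hnegI : ∀ i, Integrable (fun y => max (-descConj (γ i) (M i) (hM i) F y) 0) (ν i) := by
    intro i
    refine (integrable_toReal_of_lintegral_ne_top (hdm hNm i).aemeasurable (hfN i)).congr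
      (Eventually.of_forall fun y => ?_)
    simp only [hNdesc i y, ENNReal.toReal_ofReal']
  have hdescInt : ∀ i, Integrable (descConj (γ i) (M i) (hM i) F) (ν i) := fun i =>
    ((hposI i).sub (hnegI i)).congr
      (Eventually.of_forall fun y => max_zero_sub_max_neg_zero_eq_self _)
  have hIPr : ∀ i, (∫⁻ y, descConj (γ i) (M i) (hM i) P y ∂(ν i)).toReal =
      ∫ y, max (descConj (γ i) (M i) (hM i) F y) 0 ∂(ν i) := by
    intro i
    rw [← integral_toReal (hdm hPm i).aemeasurable
      (Eventually.of_forall fun y => by rw [hPdesc]; exact ENNReal.ofReal_lt_top)]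
    refine integral_congr_ae (Eventually.of_forall fun y => ?_)
    simp only [hPdesc i y, ENNReal.toReal_ofReal']
  have hINr : ∀ i, (∫⁻ y, descConj (γ i) (M i) (hM i) N y ∂(ν i)).toReal =
      ∫ y, max (-descConj (γ i) (M i) (hM i) F y) 0 ∂(ν i) := by
    intro i
    rw [← integral_toReal (hdm hNm i).aemeasurable
      (Eventually.of_forall fun y => by rw [hNdesc]; exact ENNReal.ofReal_lt_top)]
    refine integral_congr_ae (Eventually.of_forall fun y => ?_)
    simp only [hNdesc i y, ENNReal.toReal_ofReal']
  have hIi : ∀ i, ∫ y, descConj (γ i) (M i) (hM i) F y ∂(ν i) =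
      (∫⁻ y, descConj (γ i) (M i) (hM i) P y ∂(ν i)).toReal -
        (∫⁻ y, descConj (γ i) (M i) (hM i) N y ∂(ν i)).toReal := by
    intro i
    rw [hIPr, hINr, ← integral_sub (hposI i) (hnegI i)]
    exact integral_congr_ae (Eventually.of_forall fun y =>
      (max_zero_sub_max_neg_zero_eq_self _).symm)
  -- integrability and integral on `G ⧸ L`
  have hae : ∀ᵐ x ∂μ, conjTsum L S hS A x < ∞ := ae_lt_top (hmc hAm) hfinA
  have heq : (fun x => (conjTsum L S hS P x).toReal - (conjTsum L S hS N x).toReal) =ᵐ[μ]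
      conjTsum L S hS F := by
    filter_upwards [hae] with x hx
    induction x using QuotientGroup.induction_on with
    | H g => exact (conjTsum_real_eq_toReal_sub L S hS F g hx).symm
  have hintP : Integrable (fun x => (conjTsum L S hS P x).toReal) μ :=
    integrable_toReal_of_lintegral_ne_top (hmc hPm).aemeasurable hfinP
  have hintN : Integrable (fun x => (conjTsum L S hS N x).toReal) μ :=
    integrable_toReal_of_lintegral_ne_top (hmc hNm).aemeasurable hfinN
  have hint : Integrable (conjTsum L S hS F) μ := (hintP.sub hintN).congr heq
  have hX : ∫ x, conjTsum L S hS F x ∂μ =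
      (∫⁻ x, conjTsum L S hS P x ∂μ).toReal - (∫⁻ x, conjTsum L S hS N x ∂μ).toReal := by
    rw [← integral_congr_ae heq, integral_sub hintP hintN,
      integral_toReal (hmc hPm).aemeasurable (ae_lt_top (hmc hPm) hfinP),
      integral_toReal (hmc hNm).aemeasurable (ae_lt_top (hmc hNm) hfinN)]
  -- the real series
  have hsumP : Summable fun i =>
      (d i).toReal * (∫⁻ y, descConj (γ i) (M i) (hM i) P y ∂(ν i)).toReal := by
    simpa only [ENNReal.toReal_mul] using ENNReal.summable_toReal hsP
  have hsumN : Summable fun i =>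
      (d i).toReal * (∫⁻ y, descConj (γ i) (M i) (hM i) N y ∂(ν i)).toReal := by
    simpa only [ENNReal.toReal_mul] using ENNReal.summable_toReal hsN
  have hXP : (∫⁻ x, conjTsum L S hS P x ∂μ).toReal =
      ∑' i, (d i).toReal * (∫⁻ y, descConj (γ i) (M i) (hM i) P y ∂(ν i)).toReal := by
    rw [hIP, ENNReal.tsum_toReal_eq htP]
    simp only [ENNReal.toReal_mul]
  have hXN : (∫⁻ x, conjTsum L S hS N x ∂μ).toReal =
      ∑' i, (d i).toReal * (∫⁻ y, descConj (γ i) (M i) (hM i) N y ∂(ν i)).toReal := by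
    rw [hIN, ENNReal.tsum_toReal_eq htN]
    simp only [ENNReal.toReal_mul]
  -- absolute convergence of the right-hand side
  have habs : Summable fun i => (d i).toReal * ∫ y, ‖descConj (γ i) (M i) (hM i) F y‖ ∂(ν i) := by
    have h1 : ∀ i, ∫ y, ‖descConj (γ i) (M i) (hM i) F y‖ ∂(ν i) =
        (∫⁻ y, descConj (γ i) (M i) (hM i) A y ∂(ν i)).toReal := fun i => by
      rw [integral_norm_eq_lintegral_enorm (hdF i).aestronglyMeasurable]
      congr 1
      exact lintegral_congr fun y => (hAdesc i y).symm
    simp_rw [h1]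
    simpa only [ENNReal.toReal_mul] using ENNReal.summable_toReal hsA
  refine ⟨hint, hdescInt, habs, ?_⟩
  calc ∫ x, conjTsum L S hS F x ∂μ
      = (∫⁻ x, conjTsum L S hS P x ∂μ).toReal - (∫⁻ x, conjTsum L S hS N x ∂μ).toReal := hX
    _ = ∑' i, (d i).toReal * (∫⁻ y, descConj (γ i) (M i) (hM i) P y ∂(ν i)).toReal -
          ∑' i, (d i).toReal * (∫⁻ y, descConj (γ i) (M i) (hM i) N y ∂(ν i)).toReal := by
        rw [hXP, hXN]
    _ = ∑' i, ((d i).toReal * (∫⁻ y, descConj (γ i) (M i) (hM i) P y ∂(ν i)).toReal -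
          (d i).toReal * (∫⁻ y, descConj (γ i) (M i) (hM i) N y ∂(ν i)).toReal) :=
        (hsumP.tsum_sub hsumN).symm
    _ = ∑' i, (d i).toReal * ∫ y, descConj (γ i) (M i) (hM i) F y ∂(ν i) :=
        tsum_congr fun i => by rw [hIi i, mul_sub]

/-- **The geometric side for complex integrands** (the form used for the trace formula, whose
test functions are complex): under the `[0, ∞]`-valued identity of
`integral_conjTsum_eq_tsum_of_lintegral`, for every Borel `F : G → ℂ` with
`∫_{G ⧸ L} Σ'_{s ∈ S} ‖F(x s x⁻¹)‖ dμ < ∞` the sum over conjugates is `μ`-integrable, the orbital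
integrands are integrable, the right-hand side converges absolutely and
`∫_{G ⧸ L} Σ'_{s ∈ S} F(x s x⁻¹) dμ(x) = Σ'_i d_i ∫_{G ⧸ M_i} F(y γ_i y⁻¹) dν_i(y)`
(real and imaginary parts, `integral_conjTsum_eq_tsum_of_lintegral`).
[cite: Gelbart1975, (9.13) and Remark 9.23] -/
theorem integral_conjTsum_eq_tsum_of_lintegral_complex (hd0 : ∀ i, d i ≠ 0)
    (hId : ∀ F : G → ℝ≥0∞, Measurable F →
      ∫⁻ x, conjTsum L S hS F x ∂μ = ∑' i, d i * ∫⁻ y, descConj (γ i) (M i) (hM i) F y ∂(ν i))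
    {F : G → ℂ} (hF : Measurable F)
    (hfin : ∫⁻ x, conjTsum L S hS (fun g => ‖F g‖ₑ) x ∂μ < ∞) :
    Integrable (conjTsum L S hS F) μ ∧
    (∀ i, Integrable (descConj (γ i) (M i) (hM i) F) (ν i)) ∧
    Summable (fun i => (d i).toReal * ∫ y, ‖descConj (γ i) (M i) (hM i) F y‖ ∂(ν i)) ∧
    ∫ x, conjTsum L S hS F x ∂μ =
      ∑' i, ((d i).toReal : ℂ) * ∫ y, descConj (γ i) (M i) (hM i) F y ∂(ν i) := by
  set A : G → ℝ≥0∞ := fun g => ‖F g‖ₑ with hA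
  have hAm : Measurable A := hF.enorm
  set Fr : G → ℝ := fun g => (F g).re with hFr'
  set Fi : G → ℝ := fun g => (F g).im with hFi'
  have hFr : Measurable Fr := Complex.measurable_re.comp hF
  have hFi : Measurable Fi := Complex.measurable_im.comp hF
  have hrA : ∀ g, ‖Fr g‖ₑ ≤ A g := fun g => by
    change ‖(F g).re‖ₑ ≤ ‖F g‖ₑ
    rw [← ofReal_norm, ← ofReal_norm]
    exact ENNReal.ofReal_le_ofReal ((Real.norm_eq_abs _).trans_le (Complex.abs_re_le_norm _))
  have hiA : ∀ g, ‖Fi g‖ₑ ≤ A g := fun g => by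
    change ‖(F g).im‖ₑ ≤ ‖F g‖ₑ
    rw [← ofReal_norm, ← ofReal_norm]
    exact ENNReal.ofReal_le_ofReal ((Real.norm_eq_abs _).trans_le (Complex.abs_im_le_norm _))
  have hfinr : ∫⁻ x, conjTsum L S hS (fun g => ‖Fr g‖ₑ) x ∂μ < ∞ :=
    lt_of_le_of_lt (lintegral_mono fun x => conjTsum_mono L S hS hrA x) hfin
  have hfini : ∫⁻ x, conjTsum L S hS (fun g => ‖Fi g‖ₑ) x ∂μ < ∞ :=
    lt_of_le_of_lt (lintegral_mono fun x => conjTsum_mono L S hS hiA x) hfin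
  obtain ⟨hintr, -, -, hIr⟩ :=
    integral_conjTsum_eq_tsum_of_lintegral L S hS μ γ M hM ν hd0 hId hFr hfinr
  obtain ⟨hinti, -, -, hIi⟩ :=
    integral_conjTsum_eq_tsum_of_lintegral L S hS μ γ M hM ν hd0 hId hFi hfini
  -- the complex sum over conjugates in terms of its real and imaginary parts, a.e.
  have hmcA : Measurable (conjTsum L S hS A) := measurable_conjTsum L S hS hL hAm
  have hae : ∀ᵐ x ∂μ, conjTsum L S hS A x < ∞ := ae_lt_top hmcA hfin.ne
  have hdecomp : ∀ g : G, conjTsum L S hS A (QuotientGroup.mk g) < ∞ →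
      conjTsum L S hS F (QuotientGroup.mk g) =
        ((conjTsum L S hS Fr (QuotientGroup.mk g) : ℝ) : ℂ) +
          (conjTsum L S hS Fi (QuotientGroup.mk g) : ℝ) * Complex.I := by
    intro g hg
    simp only [conjTsum_mk] at hg ⊢
    have hsum : Summable fun s : S => F (g * s * g⁻¹) := by
      refine Summable.of_norm ?_
      have := ENNReal.summable_toReal hg.ne
      simpa only [hA, toReal_enorm] using this
    rw [← Complex.re_tsum hsum, ← Complex.im_tsum hsum, Complex.re_add_im]
  have heq : (fun x => ((conjTsum L S hS Fr x : ℝ) : ℂ) + (conjTsum L S hS Fi x : ℝ) * Complex.I)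
      =ᵐ[μ] conjTsum L S hS F := by
    filter_upwards [hae] with x hx
    induction x using QuotientGroup.induction_on with
    | H g => exact (hdecomp g hx).symm
  have hint : Integrable (conjTsum L S hS F) μ :=
    (hintr.ofReal.add (hinti.ofReal.mul_const _)).congr heq
  -- the orbital integrands
  have hIA := hId A hAm
  have hsA : ∑' i, d i * ∫⁻ y, descConj (γ i) (M i) (hM i) A y ∂(ν i) ≠ ∞ := by
    rw [← hIA]; exact hfin.ne
  have hfA : ∀ i, ∫⁻ y, descConj (γ i) (M i) (hM i) A y ∂(ν i) ≠ ∞ := fun i h =>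
    (ne_top_of_le_ne_top hsA (ENNReal.le_tsum i)) (by rw [h, ENNReal.mul_top (hd0 i)])
  have hAdesc : ∀ i y, descConj (γ i) (M i) (hM i) A y =
      ‖descConj (γ i) (M i) (hM i) F y‖ₑ := fun i y => by
    induction y using QuotientGroup.induction_on; rfl
  have hdF : ∀ i, Measurable (descConj (γ i) (M i) (hM i) F) := fun i =>
    measurable_descConj _ _ _ hF
  have hdescInt : ∀ i, Integrable (descConj (γ i) (M i) (hM i) F) (ν i) := fun i =>
    ⟨(hdF i).aestronglyMeasurable, by
      rw [hasFiniteIntegral_iff_enorm]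
      calc ∫⁻ y, ‖descConj (γ i) (M i) (hM i) F y‖ₑ ∂(ν i)
          = ∫⁻ y, descConj (γ i) (M i) (hM i) A y ∂(ν i) :=
            lintegral_congr fun y => (hAdesc i y).symm
        _ < ∞ := (hfA i).lt_top⟩
  have habs : Summable fun i => (d i).toReal * ∫ y, ‖descConj (γ i) (M i) (hM i) F y‖ ∂(ν i) := by
    have h1 : ∀ i, ∫ y, ‖descConj (γ i) (M i) (hM i) F y‖ ∂(ν i) =
        (∫⁻ y, descConj (γ i) (M i) (hM i) A y ∂(ν i)).toReal := fun i => by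
      rw [integral_norm_eq_lintegral_enorm (hdF i).aestronglyMeasurable]
      congr 1
      exact lintegral_congr fun y => (hAdesc i y).symm
    simp_rw [h1]
    simpa only [ENNReal.toReal_mul] using ENNReal.summable_toReal hsA
  have hsumC : Summable fun i => ((d i).toReal : ℂ) * ∫ y, descConj (γ i) (M i) (hM i) F y ∂(ν i) := by
    refine Summable.of_norm_bounded habs fun i => ?_
    rw [norm_mul, Complex.norm_real, Real.norm_of_nonneg ENNReal.toReal_nonneg]
    exact mul_le_mul_of_nonneg_left (norm_integral_le_integral_norm _) ENNReal.toReal_nonneg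
  -- real and imaginary parts of the orbital integrals
  have hre : ∀ i, (∫ y, descConj (γ i) (M i) (hM i) F y ∂(ν i)).re =
      ∫ y, descConj (γ i) (M i) (hM i) Fr y ∂(ν i) := fun i => by
    rw [← RCLike.re_to_complex, ← integral_re (hdescInt i)]
    refine integral_congr_ae (Eventually.of_forall fun y => ?_)
    induction y using QuotientGroup.induction_on; rfl
  have him : ∀ i, (∫ y, descConj (γ i) (M i) (hM i) F y ∂(ν i)).im =
      ∫ y, descConj (γ i) (M i) (hM i) Fi y ∂(ν i) := fun i => by
    rw [← RCLike.im_to_complex, ← integral_im (hdescInt i)]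
    refine integral_congr_ae (Eventually.of_forall fun y => ?_)
    induction y using QuotientGroup.induction_on; rfl
  -- real and imaginary parts of the integral over `G ⧸ L`
  have hXre : (∫ x, conjTsum L S hS F x ∂μ).re = ∫ x, conjTsum L S hS Fr x ∂μ := by
    rw [← RCLike.re_to_complex, ← integral_re hint]
    refine integral_congr_ae ?_
    filter_upwards [hae] with x hx
    induction x using QuotientGroup.induction_on with
    | H g =>
      rw [RCLike.re_to_complex, hdecomp g hx]
      simp
  have hXim : (∫ x, conjTsum L S hS F x ∂μ).im = ∫ x, conjTsum L S hS Fi x ∂μ := by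
    rw [← RCLike.im_to_complex, ← integral_im hint]
    refine integral_congr_ae ?_
    filter_upwards [hae] with x hx
    induction x using QuotientGroup.induction_on with
    | H g =>
      rw [RCLike.im_to_complex, hdecomp g hx]
      simp
  refine ⟨hint, hdescInt, habs, Complex.ext ?_ ?_⟩
  · rw [hXre, hIr, Complex.re_tsum hsumC]
    exact tsum_congr fun i => by rw [Complex.re_ofReal_mul, hre]
  · rw [hXim, hIi, Complex.im_tsum hsumC]
    exact tsum_congr fun i => by rw [Complex.im_ofReal_mul, him]

end Integral

end Literature.MeasureTheory.Group
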